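import Literature.AlgebraicGeometry.Resolution.RegularLocalOrderValuation
import HarnessLib

/-!
# `𝔪`-adic order in a local ring: negation, subtraction, units, powers, sums, local homomorphisms

Topic: `Literature/AlgebraicGeometry/Resolution` (tree library; cell `res-hironaka`, librarian res-D-lib-2, DEDUPE HOIST of
«power-series-order» helpers). The tree's `adicOrder` (`RegularLocalOrderValuation.lean`: `le_adicOrder_iff`,
`min_adicOrder_le_add`, `adicOrder_add_adicOrder_le_mul`, `adicOrder_of_isUnit`; `adicOrder_mul` / `adicOrder_pow` on a REGULAR
local ring) lacks the small general-local-ring companions that the lane's proof files re-prove PRIVATELY over and over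
(`adicOrder_neg` ×15, `adicOrder_unit_mul` ×5, `nsmul_adicOrder_le_pow'` ×5 — census
`D/res-D-lib-2/private_dupes.py`, 2026-08-27). This file is their public home:

* any local ring: `adicOrder_neg`, `adicOrder_sub_comm`, `min_adicOrder_le_sub`, `adicOrder_mul_of_isUnit_right`
  (the left form is `Hironaka2017.….LLHeadsRhoStable.adicOrder_mul_of_isUnit_left` / `Rem99.adicOrder_unit_mul`, not restated),
  `le_adicOrder_mul_right` (`ord f ≤ ord (f·g)`; the left form `ord g ≤ ord (f·g)` is ALREADY public as `Literature.AlgebraicGeometry.Hironaka2017.S06BaseHike.adicOrder_le_adicOrder_mul_left`, `Proofs/S06BaseHike/LLHeadsRhoStable.lean` — gate dedup), `nsmul_adicOrder_le_pow` (`n • ord w ≤ ord (wⁿ)`),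
  `le_adicOrder_pow_of_mem` (`w ∈ 𝔪 ⇒ n ≤ ord (wⁿ)`), `adicOrder_finset_sum_ge` (a common lower bound passes to sums),
  `adicOrder_eq_of_lt` (`ord f < ord g ⇒ ord (f + g) = ord f`), `adicOrder_pos_iff` (`0 < ord f ↔ f ∈ 𝔪`),
  `adicOrder_le_adicOrder_map` (a LOCAL ring homomorphism does not decrease the order);
* NOT here (already public): on `K⟦x_σ⟧` the bridge `adicOrder f = MvPowerSeries.order f` is
  `Literature.RingTheory.MvPowerSeries.adicOrder_eq_order` (`HasseDerivExactOrder.lean`; `𝔪^N` ↔ coefficients / order in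
  `Literature.RingTheory.MvPowerSeries.Jets.le_order_iff_mem_maximalIdeal_pow`, `MaximalIdealPow.lean`); regular local rings:
  `adicOrder_mul`, `adicOrder_pow`, `ordAddVal` (`RegularLocalOrderValuation.lean`).

## References
* O. Zariski, P. Samuel, *Commutative Algebra* II, Ch. VIII §1 (order function of an ideal-adic filtration). [ZariskiSamuel1960]
-/

namespace Literature.AlgebraicGeometry.Resolution

open IsLocalRing

universe u

section LocalRing

variable {R : Type u} [CommRing R] [IsLocalRing R]

/-- `ord (−f) = ord f`. [cite: ZariskiSamuel1960, Ch. VIII §1] -/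
@[simp] theorem adicOrder_neg (f : R) : adicOrder (-f) = adicOrder f := by
  refine le_antisymm ?_ ?_ <;> refine ENat.forall_natCast_le_iff_le.mp fun n hn => ?_
  · rw [le_adicOrder_iff] at hn ⊢; simpa using hn
  · rw [le_adicOrder_iff] at hn ⊢; exact Submodule.neg_mem _ hn

/-- `ord (f − g) = ord (g − f)`. [cite: ZariskiSamuel1960, Ch. VIII §1] -/
theorem adicOrder_sub_comm (f g : R) : adicOrder (f - g) = adicOrder (g - f) := by
  rw [← neg_sub, adicOrder_neg]

/-- `min (ord f) (ord g) ≤ ord (f − g)`. [cite: ZariskiSamuel1960, Ch. VIII §1] -/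
theorem min_adicOrder_le_sub (f g : R) : min (adicOrder f) (adicOrder g) ≤ adicOrder (f - g) := by
  rw [sub_eq_add_neg, ← adicOrder_neg g]
  exact min_adicOrder_le_add f (-g)

/-- `0 < ord f ↔ f ∈ 𝔪`. [cite: ZariskiSamuel1960, Ch. VIII §1] -/
theorem adicOrder_pos_iff (f : R) : 0 < adicOrder f ↔ f ∈ maximalIdeal R := by
  rw [← pow_one (maximalIdeal R), ← le_adicOrder_iff, Nat.cast_one, Order.one_le_iff_pos]

/-- `ord f = 0 ↔ f` is a unit. [cite: ZariskiSamuel1960, Ch. VIII §1] -/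
theorem adicOrder_eq_zero_iff (f : R) : adicOrder f = 0 ↔ IsUnit f := by
  rw [← not_iff_not, ← ne_eq, ← pos_iff_ne_zero, adicOrder_pos_iff]
  exact (IsLocalRing.mem_maximalIdeal f)

/-- `ord f ≤ ord (f·g)`. [cite: ZariskiSamuel1960, Ch. VIII §1] -/
theorem le_adicOrder_mul_right (f g : R) : adicOrder f ≤ adicOrder (f * g) :=
  le_trans (by simp) (adicOrder_add_adicOrder_le_mul f g)

/-- Multiplication by a unit on the RIGHT does not change the order (left form: the lane's
`adicOrder_mul_of_isUnit_left` / `adicOrder_unit_mul`). [cite: ZariskiSamuel1960, Ch. VIII §1] -/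
theorem adicOrder_mul_of_isUnit_right (f : R) {u : R} (hu : IsUnit u) : adicOrder (f * u) = adicOrder f := by
  refine le_antisymm ?_ (le_adicOrder_mul_right f u)
  obtain ⟨v, rfl⟩ := hu
  calc adicOrder (f * ↑v) ≤ adicOrder (f * ↑v * ↑v⁻¹) := le_adicOrder_mul_right _ _
    _ = adicOrder f := by rw [Units.mul_inv_cancel_right]

/-- `n • ord w ≤ ord (wⁿ)` in ANY local ring (equality `adicOrder_pow` holds in a regular local ring).
[cite: ZariskiSamuel1960, Ch. VIII §1] -/
theorem nsmul_adicOrder_le_pow (w : R) (n : ℕ) : (n : ℕ∞) * adicOrder w ≤ adicOrder (w ^ n) := by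
  induction n with
  | zero => simp
  | succ n ih =>
    calc ((n + 1 : ℕ) : ℕ∞) * adicOrder w = (n : ℕ∞) * adicOrder w + adicOrder w := by push_cast; ring
      _ ≤ adicOrder (w ^ n) + adicOrder w := add_le_add ih le_rfl
      _ ≤ adicOrder (w ^ n * w) := adicOrder_add_adicOrder_le_mul _ _
      _ = adicOrder (w ^ (n + 1)) := by rw [pow_succ]

/-- `w ∈ 𝔪 ⇒ n ≤ ord (wⁿ)`. [cite: ZariskiSamuel1960, Ch. VIII §1] -/
theorem le_adicOrder_pow_of_mem {w : R} (hw : w ∈ maximalIdeal R) (n : ℕ) : (n : ℕ∞) ≤ adicOrder (w ^ n) :=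
  (le_adicOrder_iff _ n).mpr (Ideal.pow_mem_pow hw n)

/-- A common lower bound passes to finite sums: `(∀ i ∈ s, n ≤ ord (f i)) ⇒ n ≤ ord (∑_{i∈s} f i)`.
[cite: ZariskiSamuel1960, Ch. VIII §1] -/
theorem le_adicOrder_finset_sum {ι : Type*} (s : Finset ι) (f : ι → R) {n : ℕ}
    (h : ∀ i ∈ s, (n : ℕ∞) ≤ adicOrder (f i)) : (n : ℕ∞) ≤ adicOrder (∑ i ∈ s, f i) := by
  rw [le_adicOrder_iff]
  exact Submodule.sum_mem _ fun i hi => (le_adicOrder_iff _ n).mp (h i hi)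

/-- `ord f < ord g ⇒ ord (f + g) = ord f` (the strict triangle equality). [cite: ZariskiSamuel1960, Ch. VIII §1] -/
theorem adicOrder_add_eq_left_of_lt {f g : R} (h : adicOrder f < adicOrder g) : adicOrder (f + g) = adicOrder f := by
  refine le_antisymm ?_ ?_
  · -- `f = (f + g) + (−g)` and `ord (−g) = ord g > ord f`
    by_contra hlt
    rw [not_le] at hlt
    have h1 : min (adicOrder (f + g)) (adicOrder (-g)) ≤ adicOrder (f + g + -g) := min_adicOrder_le_add _ _
    rw [add_neg_cancel_right, adicOrder_neg] at h1
    have : min (adicOrder (f + g)) (adicOrder g) > adicOrder f := lt_min hlt h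
    exact absurd (lt_of_lt_of_le this h1) (lt_irrefl _)
  · calc adicOrder f = min (adicOrder f) (adicOrder g) := (min_eq_left h.le).symm
      _ ≤ adicOrder (f + g) := min_adicOrder_le_add f g

/-- `ord f < ord g ⇒ ord (f − g) = ord f`. [cite: ZariskiSamuel1960, Ch. VIII §1] -/
theorem adicOrder_sub_eq_left_of_lt {f g : R} (h : adicOrder f < adicOrder g) : adicOrder (f - g) = adicOrder f := by
  rw [sub_eq_add_neg]
  exact adicOrder_add_eq_left_of_lt (by rwa [adicOrder_neg])

/-- A LOCAL homomorphism of local rings does not decrease the order: `ord_R f ≤ ord_S (φ f)` (`φ(𝔪_R) ⊆ 𝔪_S`).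
[cite: ZariskiSamuel1960, Ch. VIII §1] -/
theorem adicOrder_le_adicOrder_map {S : Type*} [CommRing S] [IsLocalRing S] (φ : R →+* S) [IsLocalHom φ] (f : R) :
    adicOrder f ≤ adicOrder (φ f) := by
  refine ENat.forall_natCast_le_iff_le.mp fun n hn => ?_
  rw [le_adicOrder_iff] at hn ⊢
  have hle : (maximalIdeal R).map φ ≤ maximalIdeal S :=
    ((IsLocalRing.local_hom_TFAE φ).out 0 2).mp ‹_›
  exact Ideal.pow_right_mono hle n (Ideal.map_pow φ (maximalIdeal R) n ▸ Ideal.mem_map_of_mem φ hn)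

/-- The order is invariant under ring isomorphisms of local rings (cf. the lane's `adicOrder_ringEquiv` in
`Proofs/S10LLChainMod/Lem10p1c`, stated there for `≃+*` as a hypothesis-free rewrite; here via the two local homs).
[cite: ZariskiSamuel1960, Ch. VIII §1] -/
theorem adicOrder_map_ringEquiv {S : Type*} [CommRing S] [IsLocalRing S] (e : R ≃+* S) (f : R) :
    adicOrder (e f) = adicOrder f := by
  haveI : IsLocalHom (e : R →+* S) := ⟨fun a ha => by simpa using ha.map e.symm⟩
  haveI : IsLocalHom (e.symm : S →+* R) := ⟨fun a ha => by simpa using ha.map e⟩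
  refine le_antisymm ?_ (adicOrder_le_adicOrder_map (e : R →+* S) f)
  have := adicOrder_le_adicOrder_map (e.symm : S →+* R) (e f)
  simpa using this

end LocalRing

/-! ## Appendix (rev 2): order one / order at least one -/

section RevTwo

variable {R : Type u} [CommRing R] [IsLocalRing R]

/-- `ord t ≠ 0 ⇒ t ∈ 𝔪` (in particular for `ord t = 1`, the «`t_mem`» step re-proved privately in six §9/§10/§14 files).
[cite: ZariskiSamuel1960, Ch. VIII §1] -/
theorem mem_maximalIdeal_of_adicOrder_ne_zero {t : R} (ht : adicOrder t ≠ 0) : t ∈ maximalIdeal R :=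
  (adicOrder_pos_iff t).mp (pos_iff_ne_zero.mpr ht)

/-- `ord t = 1 ⇒ t ∈ 𝔪`. [cite: ZariskiSamuel1960, Ch. VIII §1] -/
theorem mem_maximalIdeal_of_adicOrder_eq_one {t : R} (ht : adicOrder t = 1) : t ∈ maximalIdeal R :=
  mem_maximalIdeal_of_adicOrder_ne_zero (by rw [ht]; exact one_ne_zero)

/-- `ord t = 1 ⇒ t ∉ 𝔪²`. [cite: ZariskiSamuel1960, Ch. VIII §1] -/
theorem not_mem_sq_of_adicOrder_eq_one {t : R} (ht : adicOrder t = 1) : t ∉ maximalIdeal R ^ 2 := by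
  rw [← adicOrder_lt_iff, ht]
  exact_mod_cast Nat.lt_succ_self 1

/-- `ord t = 1 ↔ t ∈ 𝔪 ∖ 𝔪²` (the forward conjunction alone is the lane's `Hironaka2017.S09.….mem_and_not_mem_sq_of_adicOrder_eq_one`,
`Proofs/S09/Thm918.lean`). [cite: ZariskiSamuel1960, Ch. VIII §1] -/
theorem adicOrder_eq_one_iff (t : R) : adicOrder t = 1 ↔ t ∈ maximalIdeal R ∧ t ∉ maximalIdeal R ^ 2 := by
  constructor
  · exact fun h => ⟨mem_maximalIdeal_of_adicOrder_eq_one h, not_mem_sq_of_adicOrder_eq_one h⟩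
  · rintro ⟨h1, h2⟩
    refine le_antisymm ?_ ?_
    · have := (adicOrder_le_iff t 1).mpr (by simpa using h2)
      exact_mod_cast this
    · rw [← Nat.cast_one, le_adicOrder_iff, pow_one]; exact h1

/-- `ord f ≠ 0 ↔ ¬ IsUnit f` (complement of `adicOrder_eq_zero_iff`). [cite: ZariskiSamuel1960, Ch. VIII §1] -/
theorem adicOrder_ne_zero_iff (f : R) : adicOrder f ≠ 0 ↔ ¬ IsUnit f := by
  rw [ne_eq, adicOrder_eq_zero_iff]

/-- The frequent special case `ord t = 1`, `u` a unit ⇒ `ord (t·u) = 1`. [cite: ZariskiSamuel1960, Ch. VIII §1] -/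
theorem adicOrder_mul_unit_eq_one {t u : R} (ht : adicOrder t = 1) (hu : IsUnit u) : adicOrder (t * u) = 1 := by
  rw [adicOrder_mul_of_isUnit_right t hu, ht]

end RevTwo

end Literature.AlgebraicGeometry.Resolution
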